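import Literature.NumberTheory.Automorphic.UnitaryGroupSingularTermValue
import HarnessLib

/-!
# The singular term of `U(J₃)` in the form `𝔄 · log T + 𝔅`
(Rogawski, *Automorphic Representations of Unitary Groups in Three Variables* (1990), §7.2 Prop. 7.2.2, pp. 94–95.)

Topic `NumberTheory/Automorphic`; namespace `Literature.NumberTheory.Automorphic.UnitaryGroup`. THEOREMS ONLY over
accepted tree modules: no definition, no named fact, no instance, no notation, no `sorry`. Row (L5-iii-c) of the T1-qs
LAW 5 road (`Cruxes/H413/Lines/F0_T1InnerFormTraceIdentity.lean`), brick (c5)(12): the corollary of ★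
`exists_integral_weight_smul_singularBracket_eq` (`UnitaryGroupSingularTermValue`) in the currency of the (σ-ii) finset
closer — the value is AFFINE IN `log T` with the `log`-coefficient
`𝔄 = C · V₀ · ½ · V_F · μ_A(D_F)⁻¹ · 𝔉f♭(0)` spelled out and the constant `𝔅` existential (`log(T/H₁) = log T − log H₁`).

## References
* J. D. Rogawski, *Automorphic Representations of Unitary Groups in Three Variables*, Ann. of Math. Stud. 123 (1990),
  §7.2 Prop. 7.2.2 [Rogawski1990].
-/

set_option autoImplicit false

noncomputable section

open MeasureTheory MeasureTheory.Measure NumberField IsDedekindDomain Set Literature.MeasureTheory.Group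
open scoped ENNReal NNReal MatrixGroups
open Literature.NumberTheory.Automorphic.Meyer

namespace Literature.NumberTheory.Automorphic

namespace UnitaryGroup

variable {F E : Type} [Field F] [NumberField F] [Field E] [NumberField E] [Algebra F E]
  {c : E ≃ₐ[F] E}

variable [LocallyCompactSpace (AdeleRing (𝓞 E) E)] [LocallyCompactSpace (AdeleRing (𝓞 F) F)]
  [MeasurableSpace (AdeleRing (𝓞 E) E)] [BorelSpace (AdeleRing (𝓞 E) E)]
  [MeasurableSpace (AdeleRing (𝓞 F) F)] [BorelSpace (AdeleRing (𝓞 F) F)]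
  [MeasurableSpace (quasiSplit F E c 3).Adelic] [BorelSpace (quasiSplit F E c 3).Adelic]
  [MeasurableSpace (GaloisRepresentations.ideleGroup F)] [BorelSpace (GaloisRepresentations.ideleGroup F)]
  [Algebra.IsQuadraticExtension F E]

/-- **THE SINGULAR TERM IS `𝔄 · log T + 𝔅` (Prop. 7.2.2, the shape consumed by the (σ-ii) finset closer).** With the data of
★ `exists_integral_weight_smul_singularBracket_eq`: there are `C > 0` and `𝔅 ∈ ℂ` such that for every `T > 0`,
`∫_G β(g) • b_T[f](g) dν_G = (C · V₀ · ½ · V_F · μ_A(D_F)⁻¹ · 𝔉f♭(0)) · log T + 𝔅` (`log(T/H₁) = log T − log H₁`).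
[cite: Rogawski1990, §7.2 Prop. 7.2.2 (pp. 94–95)] -/
theorem exists_integral_weight_smul_singularBracket_eq_mul_log_add (hc : c * c = 1) (hc1 : c ≠ 1)
    {a b : Eˣ} (hab : (a : E) ≠ (b : E)) {g₀ : (quasiSplit F E c 3).Rational} {γ₀ : (quasiSplit F E c 3).arithmeticSubgroup}
    (hg₀ : ((g₀.val : GL (Fin 3) E) : Matrix (Fin 3) (Fin 3) E) = !![(a : E), 0, 0; 0, b, 0; 0, 0, a])
    (hγ₀ : (γ₀ : (quasiSplit F E c 3).Adelic) = (quasiSplit F E c 3).toAdelic g₀)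
    {δ : E} (hcδ : c δ = -δ) (hδ : δ ≠ 0) (θ₀ : 𝓞 F) (hθ : θ₀ ≠ 0) (hd : δ * δ = algebraMap F E (θ₀ : F))
    (hsq : ¬ IsSquare ((θ₀ : 𝓞 F) : F))
    {f : (quasiSplit F E c 3).Adelic → ℂ} (hf : IsQuasiSplitTest F E c 3 f)
    (hBK : ∀ g : (quasiSplit F E c 3).Adelic, ∃ b ∈ borelAdelic F E c 3, ∃ k : (quasiSplit F E c 3).Adelic,
      adelicVal F E c 3 ((StdForm.antidiagonal 3).over E) k ∈ standardMaximalCompactGL 3 E ∧ g = b * k)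
    (νG : Measure (quasiSplit F E c 3).Adelic) [νG.IsHaarMeasure]
    (μB : Measure (borelAdelic F E c 3)) [μB.IsHaarMeasure]
    (μT : Measure (torusInBorel F E c 3)) [μT.IsHaarMeasure]
    (μK : Measure ↥((standardMaximalCompactGL 3 E).comap (adelicVal F E c 3 ((StdForm.antidiagonal 3).over E)) : Subgroup (quasiSplit F E c 3).Adelic)) [μK.IsHaarMeasure]
    (μX : Measure (AdeleRing (𝓞 E) E)) [μX.IsAddHaarMeasure] [μX.Regular]
    (μA : Measure (AdeleRing (𝓞 F) F)) [μA.IsAddHaarMeasure] [μA.Regular]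
    (νF : Measure (GaloisRepresentations.ideleGroup F)) [νF.IsHaarMeasure]
    {𝓕F : Set (GaloisRepresentations.ideleGroup F)} (h𝓕 : IsIdeleClassDomain F 𝓕F)
    {β : (quasiSplit F E c 3).Adelic → ℝ≥0∞}
    (hβ : IsCoveringWeight ((arithmeticBorel F E c 3 ⊓
      Subgroup.centralizer ({γ₀} : Set (quasiSplit F E c 3).arithmeticSubgroup)).map (quasiSplit F E c 3).arithmeticSubgroup.subtype) β)
    {wT : torusInBorel F E c 3 → ℝ≥0∞}
    (hwT : IsCoveringWeight ((rationalBorel F E c 3).subgroupOf (torusInBorel F E c 3)) wT) :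
    ∃ C : ℝ, 0 < C ∧ ∃ 𝔅 : ℂ, ∀ T : ℝ≥0, 0 < (T : ℝ) →
      ∫ g, (β g).toReal • ((∑' n : {n : ↥((adelicUnipotent F E c 3).subgroupOf (quasiSplit F E c 3).arithmeticSubgroup ⊓
            Subgroup.centralizer ({γ₀} : Set (quasiSplit F E c 3).arithmeticSubgroup)) // n ≠ 1},
          f ((g)⁻¹ * (((n.1 : (quasiSplit F E c 3).arithmeticSubgroup) * γ₀ : (quasiSplit F E c 3).arithmeticSubgroup) : (quasiSplit F E c 3).Adelic) * (g))) -
        Set.indicator {z : (quasiSplit F E c 3).Adelic | T < borelHeight z}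
          (fun z => ((μA.map (traceZeroLine F E c hcδ hδ)) (traceZeroFundamentalDomain F E c)).toReal⁻¹ • ∫ w : traceZeroAdele F E c,
            f (z⁻¹ * ((γ₀ : (quasiSplit F E c 3).Adelic) * (((heisElt hc 0 w : unipotentInBorel F E c 3) : borelAdelic F E c 3) : (quasiSplit F E c 3).Adelic)) * z) ∂(μA.map (traceZeroLine F E c hcδ hδ))) (g)) ∂νG =
        (C : ℂ) * ((((μA.map (traceZeroLine F E c hcδ hδ)).real (traceZeroFundamentalDomain F E c) : ℝ) : ℂ) *
          ((1 / 2 : ℂ) * (((idelicCovolume F νF).toReal : ℂ) * (((μA (adeleFundamentalDomain F)).toReal⁻¹ : ℂ) * adeleFourier F μA (fun s : AdeleRing (𝓞 F) F =>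
      ∫ x : AdeleRing (𝓞 E) E, (∫ k : ↥((standardMaximalCompactGL 3 E).comap (adelicVal F E c 3 ((StdForm.antidiagonal 3).over E)) : Subgroup (quasiSplit F E c 3).Adelic), f ((k : (quasiSplit F E c 3).Adelic)⁻¹ *
        (((((heisElt hc x (0 : traceZeroAdele F E c) : unipotentInBorel F E c 3) : borelAdelic F E c 3) : (quasiSplit F E c 3).Adelic))⁻¹ *
          ((γ₀ : (quasiSplit F E c 3).Adelic) * (((heisElt hc 0 (traceZeroLine F E c hcδ hδ s) : unipotentInBorel F E c 3) : borelAdelic F E c 3) : (quasiSplit F E c 3).Adelic)) *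
          (((heisElt hc x (0 : traceZeroAdele F E c) : unipotentInBorel F E c 3) : borelAdelic F E c 3) : (quasiSplit F E c 3).Adelic)) * (k : (quasiSplit F E c 3).Adelic)) ∂μK) ∂μX) 0)))) * ((Real.log (T : ℝ) : ℝ) : ℂ) + 𝔅 := by
  obtain ⟨C, hC, h⟩ := exists_integral_weight_smul_singularBracket_eq hc hc1 hab hg₀ hγ₀ hcδ hδ θ₀ hθ hd hsq hf hBK
    νG μB μT μK μX μA νF h𝓕 hβ hwT
  have hH₁ : (0 : ℝ) < ((borelHeight (1 : (quasiSplit F E c 3).Adelic) : ℝ≥0) : ℝ) := by exact_mod_cast borelHeight_pos (1 : (quasiSplit F E c 3).Adelic)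
  refine ⟨C, hC, ((C : ℂ) * ((((μA.map (traceZeroLine F E c hcδ hδ)).real (traceZeroFundamentalDomain F E c) : ℝ) : ℂ) *
          ((1 / 2 : ℂ) * (-((((idelicCovolume F νF).toReal : ℂ) * ((Real.log ((borelHeight (1 : (quasiSplit F E c 3).Adelic) : ℝ≥0) : ℝ) : ℝ) : ℂ)) * (((μA (adeleFundamentalDomain F)).toReal⁻¹ : ℂ) * adeleFourier F μA (fun s : AdeleRing (𝓞 F) F =>
      ∫ x : AdeleRing (𝓞 E) E, (∫ k : ↥((standardMaximalCompactGL 3 E).comap (adelicVal F E c 3 ((StdForm.antidiagonal 3).over E)) : Subgroup (quasiSplit F E c 3).Adelic), f ((k : (quasiSplit F E c 3).Adelic)⁻¹ *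
        (((((heisElt hc x (0 : traceZeroAdele F E c) : unipotentInBorel F E c 3) : borelAdelic F E c 3) : (quasiSplit F E c 3).Adelic))⁻¹ *
          ((γ₀ : (quasiSplit F E c 3).Adelic) * (((heisElt hc 0 (traceZeroLine F E c hcδ hδ s) : unipotentInBorel F E c 3) : borelAdelic F E c 3) : (quasiSplit F E c 3).Adelic)) *
          (((heisElt hc x (0 : traceZeroAdele F E c) : unipotentInBorel F E c 3) : borelAdelic F E c 3) : (quasiSplit F E c 3).Adelic)) * (k : (quasiSplit F E c 3).Adelic)) ∂μK) ∂μX) 0)) +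
              ((∫ x in {x | 1 ≤ (IdeleClassGroup.ideleNorm F x : ℝ)} ∩ 𝓕F,
                  ideleSum F (fun s : AdeleRing (𝓞 F) F =>
      ∫ x : AdeleRing (𝓞 E) E, (∫ k : ↥((standardMaximalCompactGL 3 E).comap (adelicVal F E c 3 ((StdForm.antidiagonal 3).over E)) : Subgroup (quasiSplit F E c 3).Adelic), f ((k : (quasiSplit F E c 3).Adelic)⁻¹ *
        (((((heisElt hc x (0 : traceZeroAdele F E c) : unipotentInBorel F E c 3) : borelAdelic F E c 3) : (quasiSplit F E c 3).Adelic))⁻¹ *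
          ((γ₀ : (quasiSplit F E c 3).Adelic) * (((heisElt hc 0 (traceZeroLine F E c hcδ hδ s) : unipotentInBorel F E c 3) : borelAdelic F E c 3) : (quasiSplit F E c 3).Adelic)) *
          (((heisElt hc x (0 : traceZeroAdele F E c) : unipotentInBorel F E c 3) : borelAdelic F E c 3) : (quasiSplit F E c 3).Adelic)) * (k : (quasiSplit F E c 3).Adelic)) ∂μK) ∂μX) x * ((IdeleClassGroup.ideleNorm F x : ℝ) : ℂ) ∂νF) +
                ((μA (adeleFundamentalDomain F)).toReal⁻¹ : ℂ) *
                  (∫ x in {x | 1 ≤ (IdeleClassGroup.ideleNorm F x : ℝ)} ∩ 𝓕F,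
                    ideleSum F (adeleFourier F μA (fun s : AdeleRing (𝓞 F) F =>
      ∫ x : AdeleRing (𝓞 E) E, (∫ k : ↥((standardMaximalCompactGL 3 E).comap (adelicVal F E c 3 ((StdForm.antidiagonal 3).over E)) : Subgroup (quasiSplit F E c 3).Adelic), f ((k : (quasiSplit F E c 3).Adelic)⁻¹ *
        (((((heisElt hc x (0 : traceZeroAdele F E c) : unipotentInBorel F E c 3) : borelAdelic F E c 3) : (quasiSplit F E c 3).Adelic))⁻¹ *
          ((γ₀ : (quasiSplit F E c 3).Adelic) * (((heisElt hc 0 (traceZeroLine F E c hcδ hδ s) : unipotentInBorel F E c 3) : borelAdelic F E c 3) : (quasiSplit F E c 3).Adelic)) *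
          (((heisElt hc x (0 : traceZeroAdele F E c) : unipotentInBorel F E c 3) : borelAdelic F E c 3) : (quasiSplit F E c 3).Adelic)) * (k : (quasiSplit F E c 3).Adelic)) ∂μK) ∂μX)) x ∂νF) -
                ((idelicCovolume F νF).toReal : ℂ) * (fun s : AdeleRing (𝓞 F) F =>
      ∫ x : AdeleRing (𝓞 E) E, (∫ k : ↥((standardMaximalCompactGL 3 E).comap (adelicVal F E c 3 ((StdForm.antidiagonal 3).over E)) : Subgroup (quasiSplit F E c 3).Adelic), f ((k : (quasiSplit F E c 3).Adelic)⁻¹ *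
        (((((heisElt hc x (0 : traceZeroAdele F E c) : unipotentInBorel F E c 3) : borelAdelic F E c 3) : (quasiSplit F E c 3).Adelic))⁻¹ *
          ((γ₀ : (quasiSplit F E c 3).Adelic) * (((heisElt hc 0 (traceZeroLine F E c hcδ hδ s) : unipotentInBorel F E c 3) : borelAdelic F E c 3) : (quasiSplit F E c 3).Adelic)) *
          (((heisElt hc x (0 : traceZeroAdele F E c) : unipotentInBorel F E c 3) : borelAdelic F E c 3) : (quasiSplit F E c 3).Adelic)) * (k : (quasiSplit F E c 3).Adelic)) ∂μK) ∂μX) 0)) +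
            (1 / 2 : ℂ) * ((∫ x in {x | 1 ≤ (IdeleClassGroup.ideleNorm F x : ℝ)} ∩ 𝓕F,
                ideleSum F (fun s : AdeleRing (𝓞 F) F =>
      ∫ x : AdeleRing (𝓞 E) E, (∫ k : ↥((standardMaximalCompactGL 3 E).comap (adelicVal F E c 3 ((StdForm.antidiagonal 3).over E)) : Subgroup (quasiSplit F E c 3).Adelic), f ((k : (quasiSplit F E c 3).Adelic)⁻¹ *
        (((((heisElt hc x (0 : traceZeroAdele F E c) : unipotentInBorel F E c 3) : borelAdelic F E c 3) : (quasiSplit F E c 3).Adelic))⁻¹ *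
          ((γ₀ : (quasiSplit F E c 3).Adelic) * (((heisElt hc 0 (traceZeroLine F E c hcδ hδ s) : unipotentInBorel F E c 3) : borelAdelic F E c 3) : (quasiSplit F E c 3).Adelic)) *
          (((heisElt hc x (0 : traceZeroAdele F E c) : unipotentInBorel F E c 3) : borelAdelic F E c 3) : (quasiSplit F E c 3).Adelic)) * (k : (quasiSplit F E c 3).Adelic)) ∂μK) ∂μX) x * (-1 : ℂ) ^ (GaloisRepresentations.quadraticArtinIndicator F ((θ₀ : 𝓞 F) : F) x).val *
                  ((IdeleClassGroup.ideleNorm F x : ℝ) : ℂ) ∂νF) +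
              ((μA (adeleFundamentalDomain F)).toReal⁻¹ : ℂ) *
                ∫ x in {x | 1 ≤ (IdeleClassGroup.ideleNorm F x : ℝ)} ∩ 𝓕F,
                  ideleSum F (adeleFourier F μA (fun s : AdeleRing (𝓞 F) F =>
      ∫ x : AdeleRing (𝓞 E) E, (∫ k : ↥((standardMaximalCompactGL 3 E).comap (adelicVal F E c 3 ((StdForm.antidiagonal 3).over E)) : Subgroup (quasiSplit F E c 3).Adelic), f ((k : (quasiSplit F E c 3).Adelic)⁻¹ *
        (((((heisElt hc x (0 : traceZeroAdele F E c) : unipotentInBorel F E c 3) : borelAdelic F E c 3) : (quasiSplit F E c 3).Adelic))⁻¹ *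
          ((γ₀ : (quasiSplit F E c 3).Adelic) * (((heisElt hc 0 (traceZeroLine F E c hcδ hδ s) : unipotentInBorel F E c 3) : borelAdelic F E c 3) : (quasiSplit F E c 3).Adelic)) *
          (((heisElt hc x (0 : traceZeroAdele F E c) : unipotentInBorel F E c 3) : borelAdelic F E c 3) : (quasiSplit F E c 3).Adelic)) * (k : (quasiSplit F E c 3).Adelic)) ∂μK) ∂μX)) x *
                    (-1 : ℂ) ^ (GaloisRepresentations.quadraticArtinIndicator F ((θ₀ : 𝓞 F) : F) x⁻¹).val ∂νF)))), fun T hT => ?_⟩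
  rw [h T hT, Real.log_div hT.ne' hH₁.ne']
  push_cast
  ring

end UnitaryGroup

end Literature.NumberTheory.Automorphic
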